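import Summits.QuantumFields.BalabanUV.T4Continuum.Support.NE9CurChartTowerPiLatticeUniform
import Literature.MathematicalPhysics.QuantumFieldTheory.Balaban1983to89.B11Ineq98W80LatticeFree

/-!
# NE9CurChartTowerPiLatticeUniformW80 — THE LATTICE-UNIFORM CHART OF `cur U` WITH THE CONCRETE W-SLOT `W = (δ/δA′)V` (`B11Eq80Current.W80`): (I-5)
# `Support/NE9CurChartTowerPiLatticeUniform.cur_chart_exists_tower_pi_lattice_uniform` (ne9-leaf-01 g96: `∃ α₁ j₁ ε₄ ε_C R_b R′` BEFORE `∀ n η m U`, the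
# W-slot an ABSTRACT `Wq` with `(C₄, a₃)` given before the lattice) WITH `Wq := W80 ρc τc U H̃_{1,k} C_k ε_C J Δ_π` AND ITS PROP. 4 PRODUCED PER LATTICE at
# LATTICE-FREE `(C₄, R_W)` by this seat's `B11Ineq98W80LatticeFree.exists_quadAnalytic_W80_latticeFree` (gen 97: [Balaban1985Averaging] Prop. 5 (157) on the
# torus letter `C_k` × the one-block letter of `H̃_{1,k}` × the kernel route (68)–(73) → (86), «C₄ depend[s] on d and L only»); radii ORDER: the Sect. C radii
# `(a_C, ε_C)` FIRST (below `ρ` and `1/(2(ΘΓ+1))`), then `C₄ := C4W …(θ₃(a_C), θ_E)…`, `R_W := min a_C ((1 − 4CG·C₂(ε_C + a_C))R_V)`, then `(j, a, ε₄)` below `a_C`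
# (`B11Eq118RegimeScalars.exists_regime_scalars` twice); cell `pub-balaban`, T4-DAG §2 node U3 ∕ §6 NE9, route R2′; NE9 crux-team (2) leaf prover 01
# (`b2b-balaban-t4-ne9-formalise-leaf-01`, gen 97); Summits-side NEW sibling leaf under this seat's INTERFACE REQUEST NE9 [NE9LEAF01-G97-IFR] (HOME/INBOX.md;
# ruling e34b3e0c (0)); nothing printed asserted

HONEST FRAMING (T4-DAG PAGE 1).  Rung (B)+1 of the FINITE-VOLUME T⁴ programme — NOT infinite volume, NOT a mass gap, NOT the Clay problem.  NE9 is a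
cell NEW ESTIMATE, NOT PRINTED in [Balaban1987RG1] ∕ [Balaban1988RG2Cluster], and NOT PROVED here («NE9 ⇐ the named binders»; spine PROVED 0∕9).  HONEST
DEPENDENCY (cell line, verbatim): continuum YM on T⁴ ⇐ BetaPertH ∧ nine spine estimates (0/9 proved); BetaPertH ⇐ (D1) ∧ (D4) ∧ CAP+tail; G-an2-4
gates asym, D1 and NE2/3/4.  The `cur U` OBJECT is ONE item of the MODEL O-NE9-1 (species (a) data); `act` ∕ `ker` and NEEDS-COORDINATOR #5 untouched.

WHAT THIS FILE PROVES (ONE theorem; 0 def, 0 sorry, axioms standard).  **`cur_chart_exists_tower_pi_lattice_uniform_W80`** — for fixed `L ≥ 3`, the fibre ∕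
trace letters, print's parameters, [Balaban1985Averaging] Prop. 2's window `α₀` with Prop. 5's radius `ρ` (`e^{4cα₀}(1 + 8C₁ρ) ≤ 2`, `4ρ ≤ c₃`, `2dC₃ρ ≤ 1`,
`2dθ ≤ L³/16`), the weight-profile bounds `ω, Ω` and the W-slot's LATTICE-FREE letters `(C_V, R_V)`, `M_r, M_t, M_J, M_Δ`: `∃ α₁ j₁ ε₄ ε_C R_b R′` BEFORE `∀`,
such that for EVERY `n`, `η` with `ηL^{n+1} = 1`, weights, period `m`, and EVERY background `U` of the MODEL block (verbatim (I-5)'s block), level maps with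
`n+1 ≤ lev₀` and the profile bounds, and EVERY fibre maps `ρc, τc` (`‖ρc‖ ≤ M_r`, `‖τc‖ ≤ M_t`), V₀-slot at `(C_V, R_V)`, currents `J`, `Δ_π` (`‖J‖₍₋₃₎ ≤ M_J`,
`‖Δ_π‖ ≤ M_Δ`): the triple (Ψ1)–(Ψ3) for `chartHB 𝔊̃_k 0 (W80 ρc τc U H̃_{1,k} C_k ε_C J Δ_π) 0 (A′ ↦ A′ + solA H̃_{1,k} 0 C_k 0 ε_C A′) ε₄ H̃_{1,k}` on
`ball 0 R_b → ball 0 R′`.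
PROOF: (I-5)'s two chart letters (`exists_norm_chartLetters_le`) and the W-slot's `∃ (α₁′, j₁′, B′, δ′)` first; `CG := ω·M_φBM_φ′·Ω`, `Θ := M_φB′M_φ′·d·K_d(δ′)`,
`Γ := C₃·2^d·2d`, `ϖ := ω³Ω`; the two-stage radii; per lattice (52) from the plaquette window, the two operator norms against `CG`, `C_k`'s letters, the Sect. C
regime (`Regime.of_normBound_zeroLinear`), the weight ratio `≤ ω³Ω`, the W-slot by `exists_quadAnalytic_W80_latticeFree`, the chart regime at `(CG, C₄, R_W)`,
`chartHB_triple_of_twoRegimes`.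
DISGUISE TEST: composition by name; no inequality of the series proved HERE; what stays DISPLAYED is (I-5)'s model block, the W-slot's letters `M_r, M_t, M_J, M_Δ,
(C_V, R_V)` (lattice-free numbers; `M_J` ≤ `ω³j₁` from the current window, `C_V` from `B11Eq98V0LettersLatticeUniform`, `M_Δ` = [5] (3.132)'s letter) and the
currents `J, Δ_π` themselves; constants crude; NOT claimed that Bałaban's 𝐇_k meets these letters (O-NE9-1; #5 UNRULED); not NE9.  What IS new: NO abstract `Wq`,
NO `(C₄, a₃)` input — the chart of `cur U` with print's `W = (δ/δA′)V` on one ball for every height, spacing and period.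
References (TYPES ∕ loci only): [Balaban1985Variational] (44)–(47) p. 285, (73) p. 289, (86)–(89) p. 291, Prop. 4 (97)–(98) pp. 292–293, (103) p. 293, Prop. 6
(117)–(121) p. 295, (172)–(175) p. 305; [Balaban1985BackgroundPropagators] (3.35)–(3.37) p. 396, (3.122)–(3.126) p. 420, Thm 3.12 p. 423, Thm 3.13 p. 426;
[Balaban1985Averaging] Prop. 2 (52)–(54) p. 26, Prop. 5 (157) p. 42.
-/

noncomputable section

open Metric Set

namespace Summit.QuantumFields.BalabanUV.T4Continuum.NE9CurChartTowerPiLatticeUniformW80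

open scoped InnerProductSpace ComplexConjugate BigOperators
open Literature.MathematicalPhysics.QuantumFieldTheory.Balaban1983to89
open B11Eq103H1Complex B11Eq115Space B11Eq174Chart
open B11Eq111FrakG (nabla115)
open B13Contraction113 (QuadAnalytic)
open B9SectCLatticeCarrier (Bond bpos btgt unshift)
open B4Sect5Torus (TSite)
open B7Prop1Explicit (U1 Wcx boxVec)
open B7Prop2Explicit (pdev AvgClosed C0 c2')
open B7Prop3Flat (c3)
open B9Eq315QTorus (perCfg cornerSite)
open B9Eq315QTower (towerP UlevOf)
open B9Eq326OperatorTower (QkW laplaceAk)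
open B9Eq310HessianOperator (adTransportW)
open B9Eq310DeltaPrime (plaqHolU)
open B9Eq324DeltaPrimeATower (laplacePrimeAk)
open B9Eq3119DeltaPiTower (laplaceAkPi)
open B11Eq118RegimeScalars (exists_regime_scalars)
open B11Eq118RegimeRadiiUniform (Regime.of_normBound_zeroLinear)
open B11Eq44COperatorTower (C2T C2T_nonneg)
open B11Eq44CLetterTower (Cck quadAnalytic_Cck analyticOnNhd_Cck)
open B7Eq43AveragedSmallnessLevelFree (pdev_perCfg_le_of_plaq)
open B11Eq117ChartLettersOnModel (exists_norm_chartLetters_le)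
open Summit.QuantumFields.BalabanUV.T4Continuum.NE9B11ChartAnalytic (chartHB_triple_of_twoRegimes)

open B11Eq80Current (W80)
open B11Eq63V0GroupCurrent (curV0)
open B11Eq98CurrentSlot (C4W C4W_nonneg)
open B11Ineq98W80LatticeFree (exists_quadAnalytic_W80_latticeFree)

variable {d : ℕ} (hd : 1 ≤ d) (L : ℕ) [NeZero L] (hL : 1 ≤ L) (hL2 : 2 ≤ L) (hL3 : 3 ≤ L) [Fact (0 < (L : ℝ))]
  {𝔸 : Type*} [NormedRing 𝔸] [NormedAlgebra ℂ 𝔸] [CompleteSpace 𝔸] [NormOneClass 𝔸] [StarRing 𝔸] [NormedStarGroup 𝔸] [StarModule ℂ 𝔸] [FiniteDimensional ℂ 𝔸]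
  {W : Type*} [NormedAddCommGroup W] [InnerProductSpace ℂ W] [FiniteDimensional ℂ W] (φ : W ≃ₗ[ℂ] 𝔸)
  {Mφ Mφ' : ℝ} (hMφ : 0 ≤ Mφ) (hMφ' : 0 ≤ Mφ') (hφ : ∀ w, ‖φ w‖ ≤ Mφ * ‖w‖) (hφ' : ∀ X, ‖φ.symm X‖ ≤ Mφ' * ‖X‖) (hstar : ∀ X : 𝔸, ‖star X‖ ≤ ‖X‖)
  {a : ℝ} (ha : 0 < a) {a' : ℝ} (ha' : 0 < a') {ϱ : ℝ} (hϱ0 : 0 ≤ ϱ) (hϱ1 : ϱ < 1)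
  (τ : 𝔸 →ₗ[ℂ] ℂ) {Cτ : ℝ} (hτ : ∀ X, ‖τ X‖ ≤ Cτ * ‖X‖) (hCτ : 0 ≤ Cτ) {Mτ : ℝ} (hτm : ∀ X Y : 𝔸, ‖τ (X * Y)‖ ≤ Mτ * ‖X‖ * ‖Y‖) (hMτ : 0 ≤ Mτ)
  {ρw : ℝ} (hρw : 0 ≤ ρw)
  (hτ₁ : ∀ X : 𝔸, τ (star X) = conj (τ X)) (hτ₂ : ∀ X Y : 𝔸, τ (X * Y) = τ (Y * X)) (hφτ : ∀ X Y : 𝔸, ⟪φ.symm X, φ.symm Y⟫_ℂ = τ (star X * Y))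
  (AQ : ℝ)
  {G : Subgroup 𝔸ˣ} (hG : AvgClosed d L G) {α₀ : ℝ} (hα₀ : 0 < α₀) (hα3 : C0 d * α₀ ≤ 1 / 3) (hα4 : 4 * α₀ ≤ c2' d L)
  {ρ : ℝ} (hρ0 : 0 < ρ) (hρ : Real.exp (4 * (800 * ((d : ℝ) + 1) ^ 2 * ((d : ℝ) + 4)) * α₀) * (1 + 8 * (131072 * ((d : ℝ) + 1) ^ 2) * ρ) ≤ 2)
  (hρ4 : 4 * ρ ≤ c3 d L) (hθ : 2 * d * B7Prop5GeneralLevels.thetaGen d L α₀ ≤ (L : ℝ) ^ 3 / 16) (hC3 : 2 * d * B7Prop5GeneralLevels.C3Gen d L * ρ ≤ 1)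
  {ω Ω : ℝ} (hω : 0 ≤ ω) (hΩ : 0 ≤ Ω)
  {CV RV Mr Mt MJ MΔ : ℝ} (hCV : 0 ≤ CV) (hRV : 0 < RV) (hMr : 0 ≤ Mr) (hMt : 0 ≤ Mt) (hMJ : 0 ≤ MJ) (hMΔ : 0 ≤ MΔ)

-- deep definitional unfolding `laplaceAkPi` ↦ `laplaceALatticeK … (π†Δπ) …` in the statement (as the host)
set_option maxRecDepth 8192 in
set_option maxHeartbeats 1600000 in -- the ≈ 50-binder block + the three-letter chart term + the W-slot block
include hd hL hL2 hL3 hMφ hMφ' hφ hφ' hstar ha ha' hϱ0 hϱ1 hτ hCτ hτm hMτ hρw hτ₁ hτ₂ hφτ hG hα₀ hα3 hα4 hρ0 hρ hρ4 hθ hC3 hω hΩ hCV hRV hMr hMt hMJ hMΔ in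
/-- **THE LATTICE-UNIFORM CHART OF `cur U` WITH THE CONCRETE W-SLOT `W = (δ/δA′)V` (`W80`)**: (I-5) `cur_chart_exists_tower_pi_lattice_uniform` with its abstract
`Wq`, `(C₄, a₃)` DISCHARGED — `∃ α₁ j₁ ε₄ ε_C R_b R′` BEFORE `∀ n η m U`, the W-slot's Prop. 4 produced per lattice by
`B11Ineq98W80LatticeFree.exists_quadAnalytic_W80_latticeFree` at lattice-free `(C₄, R_W)` (radii ORDER: the Sect. C radii `(a_C, ε_C)` first, below the caps `ρ`
and `1/(2(ΘΓ+1))`; then `C₄ := C4W … θ₃(a_C) θ_E …`, `R_W := min a_C ((1 − 4CG·C₂(ε_C + a_C))R_V)`; then `(j, a, ε₄)` below `a_C`). The currents `J`, `Δ_π`, the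
fibre maps `ρc`, `τc` and the V₀-group's slot stay universally quantified with displayed lattice-free bounds `M_J, M_Δ, M_ρ, M_τ, (C_V, R_V)`. [folklore]
[cite: Balaban1985Variational, Prop. 4 (97)–(98) pp.292–293, (103) p.293, Prop. 6 (117)–(121) p.295, (172)–(175) p.305; Balaban1985BackgroundPropagators, (3.122) p.420, Thm 3.12 p.423; Balaban1985Averaging, Prop. 5 (157) p.42] -/
theorem cur_chart_exists_tower_pi_lattice_uniform_W80 :
    ∃ α₁ j₁ ε₄ εC Rb R' : ℝ, 0 < α₁ ∧ 0 < j₁ ∧ 0 < Rb ∧ 0 < R' ∧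
      ∀ (n : ℕ) (η : ℝ) [Fact (0 < η)] (_hηL : η * (L : ℝ) ^ (n + 1) = 1) (c₀ c₁ : ℝ) [Fact (0 < c₀)] [Fact (0 < c₁)]
        (_hw : c₀ * ((L : ℝ) ^ (n + 1)) ^ d = c₁) (_hρ : |η| ^ d / c₀ ≤ ρw) (m : Fin d → ℕ) [∀ i, NeZero (m i)] (_hm : ∀ i, 1 ≤ m i)
        (U : Bond d (towerP L m (n + 1)) → 𝔸ˣ) (αU : ℕ → ℝ) (_hα0 : ∀ j, 0 ≤ αU j) (hα1 : ∀ j, αU j ≤ 1 / 64)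
        (hαL : ∀ j, 50 * (d + 1) * αU j * (L : ℝ) ^ d ≤ 1 / 2)
        (hU1 : ∀ (j : ℕ) (x : B7Prop1Explicit.Site d) (k : Fin d), perCfg (towerP L m (j + 1)) (UlevOf L m (n + 1) U j) x k ∈ U1 𝔸)
        (hreg : ∀ (j : ℕ) (y : TSite d (towerP L m j)) (k : Fin d) (ρ' : Fin d → Fin L),
          ‖((Wcx L (perCfg (towerP L m (j + 1)) (UlevOf L m (n + 1) U j)) (cornerSite L y) k (boxVec L ρ') : 𝔸ˣ) : 𝔸) - 1‖ ≤ αU j)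
        (εU : ℕ → ℝ) (_hεU : ∀ j, 0 ≤ εU j) (_hUε : ∀ (j : ℕ) (b : Bond d (towerP L m (j + 1))), ‖(UlevOf L m (n + 1) U j b : 𝔸) - 1‖ ≤ εU j)
        (_hLb : ∀ (j : ℕ) (b : Bond d (towerP L m (j + 1))), UlevOf L m (n + 1) U j b ∈ U1 𝔸)
        (α : ℝ) (_hα : 0 ≤ α) (_hαle : α ≤ α₁)
        (hUst : ∀ b, star (U b : 𝔸) = (((U b)⁻¹ : 𝔸ˣ) : 𝔸)) (_hUb : ∀ b, U b ∈ U1 𝔸) (_hUη : ∀ b, ‖(U b : 𝔸) - 1‖ ≤ α * η)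
        (_hpl : ∀ p : B9SectCLatticeCarrier.Plaq d (towerP L m (n + 1)), ‖(plaqHolU U p : 𝔸) - 1‖ ≤ α * η ^ 2)
        (_hUgrad : ∀ (x : TSite d (towerP L m (n + 1))) (μ : Fin d), ‖(U (x, μ) : 𝔸) - U (unshift μ x, μ)‖ ≤ α * η ^ 2)
        (_hRlev : ∀ (j : ℕ) (b : Bond d (towerP L m (j + 1))) (w : W), ‖adTransportW φ (UlevOf L m (n + 1) U j) b w‖ ≤ ‖w‖)
        (_hεg : ∀ j < n + 1, εU j ≤ α * ϱ ^ j) (_hAQ : ∑ j ∈ Finset.range (n + 1), αU j ≤ AQ)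
        (hpos' : ∀ x : SiteL2K ℂ d (towerP L m (n + 1)) c₀ W, x ≠ 0 → 0 < RCLike.re ⟪x, laplacePrimeAk L m n φ η U a' (c₁ := c₁) x⟫_ℂ)
        (hpos : ∀ x : BondL2K ℂ d (towerP L m (n + 1)) c₀ W, x ≠ 0 →
          0 < RCLike.re ⟪x, laplaceAk L m n φ η U hL αU hα1 hU1 hreg τ (c₀ := c₀) (c₁ := c₁) a x⟫_ℂ)
        (_hc₀η : c₀ = η ^ d) (j₀ : ℝ) (_hJ : ∀ μ y, ‖B9Eq39Adjoint.J (fun μ => B9Eq33CovDerivVector.shiftEquiv μ) (fun μ y => U (y, μ)) η μ y‖ ≤ j₀) (_hj : j₀ ≤ j₁)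
        (hposπ : ∀ x : BondL2K ℂ d (towerP L m (n + 1)) c₀ W, x ≠ 0 →
          0 < RCLike.re ⟪x, laplaceAkPi L m n φ τ η U a' hpos' hL αU hα1 hU1 hreg (c₁ := c₁) a x⟫_ℂ)
        (hQ : Function.Surjective (QkW L m n φ U hL αU hα1 hU1 hreg (c₀ := c₀) (c₁ := c₁)))
        (_hUG : ∀ (x : B7Prop1Explicit.Site d) (κ : Fin d), perCfg (towerP L m (n + 1)) U x κ ∈ G)
        (lev₀ : Bond d (towerP L m (n + 1)) → ℕ) (lev₁ : Bond d (towerP L m (n + 1)) × Fin d → ℕ) (levB : Bond d m → ℕ) (_hlev : ∀ b, n + 1 ≤ lev₀ b)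
        (_hw₀ : (NegSup.wSup (levWeight (L : ℝ) η lev₀ 1) : ℝ) ≤ ω) (_hw₁ : (NegSup.wSup (levWeight (L : ℝ) η lev₁ 2) : ℝ) ≤ ω)
        (_hw₃ : (NegSup.wInvSup (levWeight (L : ℝ) η lev₀ 3) : ℝ) ≤ Ω) (_hwB : (NegSup.wInvSup (levWeight (L : ℝ) η levB 0) : ℝ) ≤ Ω)
        (ρc : (𝔸 →L[ℂ] ℂ) →L[ℂ] 𝔸) (τc : 𝔸 →L[ℂ] ℂ) (_hρc : ‖ρc‖ ≤ Mr) (_hτc : ‖τc‖ ≤ Mt)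
        (_hqV : ∀ Y : Space115 (L : ℝ) η lev₀ lev₁ (nabla115 η U), ‖Y‖ < RV → ‖curV0 (lev₁ := lev₁) (Dc := nabla115 η U) ρc τc U Y‖ ≤ CV * ‖Y‖ ^ 2)
        (J : NegSize (L : ℝ) η lev₀ 3 𝔸) (Δπ : Space115 (L : ℝ) η lev₀ lev₁ (nabla115 η U) →L[ℂ] NegSize (L : ℝ) η lev₀ 3 𝔸) (_hJn : ‖J‖ ≤ MJ) (_hΔn : ‖Δπ‖ ≤ MΔ),
        DifferentiableOn ℂ (chartHB (frakGLatticeCLM (lev₀ := lev₀) φ hposπ hQ lev₁ (nabla115 η U))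
            0 (W80 ρc τc U (H1LatticeCLM (lev₀ := lev₀) (levB := levB) φ hposπ hQ lev₁ (nabla115 η U))
              (Cck L m η (n + 1) U lev₀ lev₁ (nabla115 η U) levB) εC J Δπ) 0 (fun A' => A' + solA (H1LatticeCLM (lev₀ := lev₀) (levB := levB) φ hposπ hQ lev₁ (nabla115 η U)) 0
              (Cck L m η (n + 1) U lev₀ lev₁ (nabla115 η U) levB) 0 εC A') ε₄
            (H1LatticeCLM (lev₀ := lev₀) (levB := levB) φ hposπ hQ lev₁ (nabla115 η U)))
          (ball (0 : NegSize (L : ℝ) η levB 0 𝔸) Rb) ∧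
        MapsTo (chartHB (frakGLatticeCLM (lev₀ := lev₀) φ hposπ hQ lev₁ (nabla115 η U))
            0 (W80 ρc τc U (H1LatticeCLM (lev₀ := lev₀) (levB := levB) φ hposπ hQ lev₁ (nabla115 η U))
              (Cck L m η (n + 1) U lev₀ lev₁ (nabla115 η U) levB) εC J Δπ) 0 (fun A' => A' + solA (H1LatticeCLM (lev₀ := lev₀) (levB := levB) φ hposπ hQ lev₁ (nabla115 η U)) 0
              (Cck L m η (n + 1) U lev₀ lev₁ (nabla115 η U) levB) 0 εC A') ε₄
            (H1LatticeCLM (lev₀ := lev₀) (levB := levB) φ hposπ hQ lev₁ (nabla115 η U)))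
          (ball (0 : NegSize (L : ℝ) η levB 0 𝔸) Rb) (ball (0 : Space115 (L : ℝ) η lev₀ lev₁ (nabla115 η U)) R') ∧
        chartHB (frakGLatticeCLM (lev₀ := lev₀) φ hposπ hQ lev₁ (nabla115 η U))
            0 (W80 ρc τc U (H1LatticeCLM (lev₀ := lev₀) (levB := levB) φ hposπ hQ lev₁ (nabla115 η U))
              (Cck L m η (n + 1) U lev₀ lev₁ (nabla115 η U) levB) εC J Δπ) 0 (fun A' => A' + solA (H1LatticeCLM (lev₀ := lev₀) (levB := levB) φ hposπ hQ lev₁ (nabla115 η U)) 0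
              (Cck L m η (n + 1) U lev₀ lev₁ (nabla115 η U) levB) 0 εC A') ε₄
            (H1LatticeCLM (lev₀ := lev₀) (levB := levB) φ hposπ hQ lev₁ (nabla115 η U)) 0 = 0 := by
  -- the two chart letters, `∃`-first (height ∕ lattice ∕ background-free `B`)
  obtain ⟨α₁, j₁, B, hα₁, hj₁, hB, HL⟩ :=
    exists_norm_chartLetters_le hd L hL hL3 φ hMφ hMφ' hφ hφ' hstar ha ha' hϱ0 hϱ1 τ hτ hCτ hτm hMτ hρw hτ₁ hτ₂ hφτ AQ
  -- the W-slot's kernel letters, `∃`-first (the one-block letter `B'`, rate `δ'` of `H̃_{1,k}`)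
  obtain ⟨α₁', j₁', B', δ', hα₁', hj₁', hB', hδ', HW⟩ :=
    exists_quadAnalytic_W80_latticeFree hd L hL hL3 φ hMφ hMφ' hφ hφ' hstar ha ha' hϱ0 hϱ1 τ hτ hCτ hτm hMτ hρw hτ₁ hτ₂ hφτ AQ
  -- ONE majorant of both operator norms, before `∀`
  obtain ⟨CG, hCGdef⟩ : ∃ CG : ℝ, CG = ω * (Mφ * B * Mφ') * Ω := ⟨_, rfl⟩
  have hCG : 0 ≤ CG := by rw [hCGdef]; positivity
  -- the lattice-free letters of the kernel route and the weight ratio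
  obtain ⟨Θ, hΘdef⟩ : ∃ Θ : ℝ, Θ = Mφ * B' * Mφ' * (d * B4Sect5Proof.latticeConst d δ') := ⟨_, rfl⟩
  obtain ⟨Γ, hΓdef⟩ : ∃ Γ : ℝ, Γ = B7Prop5GeneralLevels.C3Gen d L * (2 ^ d * (2 * d)) := ⟨_, rfl⟩
  obtain ⟨ϖ, hϖdef⟩ : ∃ ϖ : ℝ, ϖ = ω ^ 3 * Ω := ⟨_, rfl⟩
  have hK0 : 0 ≤ B4Sect5Proof.latticeConst d δ' := B4Sect5Proof.latticeConst_nonneg d hδ'.le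
  have hC30 : 0 ≤ B7Prop5GeneralLevels.C3Gen d L := by unfold B7Prop5GeneralLevels.C3Gen B7Prop5GeneralLevels.C1ppGen; positivity
  have hΘ0 : 0 ≤ Θ := by rw [hΘdef]; positivity
  have hΓ0 : 0 ≤ Γ := by rw [hΓdef]; positivity
  have hϖ0 : 0 ≤ ϖ := by rw [hϖdef]; positivity
  -- STAGE 1: the Sect. C radii `(a_C, ε_C)` from `(CG, C₂, ρ)` below the cap `min ρ (1/(2(ΘΓ+1)))`
  have hcap0 : 0 < min ρ (1 / (2 * (Θ * Γ + 1))) := lt_min hρ0 (by positivity)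
  obtain ⟨jT, aC, εC, hjT, haC, hεC, hcapT, hCdom, hCself, hCcontr⟩ :=
    exists_regime_scalars (B₀ := CG) (C₄ := C2T d α₀) (a₃ := ρ) hCG (C2T_nonneg d α₀) hρ0 hcap0
  have hεaρ : εC + aC ≤ ρ := hcapT.trans (min_le_left _ _)
  have hq : (εC + aC) * Θ * Γ ≤ 1 / 2 := by
    have h1 : εC + aC ≤ 1 / (2 * (Θ * Γ + 1)) := hcapT.trans (min_le_right _ _)
    have h2 : (εC + aC) * (Θ * Γ) ≤ 1 / (2 * (Θ * Γ + 1)) * (Θ * Γ) := mul_le_mul_of_nonneg_right h1 (by positivity)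
    have h3 : 1 / (2 * (Θ * Γ + 1)) * (Θ * Γ) ≤ 1 / 2 := by
      rw [div_mul_eq_mul_div, div_le_div_iff₀ (by positivity) (by norm_num)]; nlinarith
    nlinarith
  have h1q : 0 < 1 - 4 * CG * C2T d α₀ * (εC + aC) := by linarith
  -- STAGE 2: the W-slot's `(C₄, a₃)` at these radii (lattice-free), then the chart radii `(j, a, ε₄)` below the cap `a_C`
  obtain ⟨RW, hRWdef⟩ : ∃ RW : ℝ, RW = min aC ((1 - 4 * CG * C2T d α₀ * (εC + aC)) * RV) := ⟨_, rfl⟩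
  have hRW0 : 0 < RW := by rw [hRWdef]; exact lt_min haC (by positivity)
  have hRWa : RW ≤ aC := by rw [hRWdef]; exact min_le_left _ _
  have hRWV : RW ≤ (1 - 4 * CG * C2T d α₀ * (εC + aC)) * RV := by rw [hRWdef]; exact min_le_right _ _
  have hC₄ : 0 ≤ C4W Mr Mt MJ MΔ CG (C2T d α₀) (1 / (1 - 4 * CG * C2T d α₀ * (εC + aC)))
      ((2 * (1 / (1 - 4 * CG * C2T d α₀ * (εC + aC))) + 1) * (ϖ * (Mφ * B' * Mφ' * (d * B4Sect5Proof.latticeConst d δ'))) * (B7Prop5GeneralLevels.C3Gen d L * (2 ^ d * (2 * d))) / aC)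
      (2 * (ϖ * (Mφ * B' * Mφ' * (d * B4Sect5Proof.latticeConst d δ'))) * (B7Prop5GeneralLevels.C3Gen d L * (2 ^ d * (2 * d))) * (1 / (1 - 4 * CG * C2T d α₀ * (εC + aC)))) CV RW :=
    C4W_nonneg hMr hMt hMJ hMΔ hCG (C2T_nonneg d α₀) (by positivity) (by positivity) hCV hRW0.le
  obtain ⟨j, a'', ε₄, hj, ha'', hε₄, hcap, hdom, hself, hcontr⟩ := exists_regime_scalars hCG hC₄ hRW0 haC
  refine ⟨min (min α₁ α₁') (α₀ / 2), min j₁ j₁', ε₄, εC, a'' / (CG + 1), 1 / (1 - 4 * CG * C2T d α₀ * (εC + aC)) * (ε₄ + a''),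
    lt_min (lt_min hα₁ hα₁') (by positivity), lt_min hj₁ hj₁', by positivity, by positivity, ?_⟩
  intro n η _ hηL c₀ c₁ _ _ hw hρ' m _ hm U αU hα0 hα1 hαL hU1 hreg εU hεU hUε hLb α hα hαle hUst hUb hUη hpl hUgrad hRlev hεg hAQ hpos' hpos hc₀η j₀ hJ hj'
    hposπ hQ hUG lev₀ lev₁ levB hlev hw₀ hw₁ hw₃ hwB ρc τc hρc hτc hqV J Δπ hJn hΔn
  have hα1' : α ≤ α₁ := hαle.trans ((min_le_left _ _).trans (min_le_left _ _))
  have hα1'' : α ≤ α₁' := hαle.trans ((min_le_left _ _).trans (min_le_right _ _))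
  have hαh : α ≤ α₀ / 2 := hαle.trans (min_le_right _ _)
  have hjW : j₀ ≤ j₁' := hj'.trans (min_le_right _ _)
  have hj'' : j₀ ≤ j₁ := hj'.trans (min_le_left _ _)
  -- (52) from the PLAQUETTE window
  have hη : ((L : ℝ) ^ (n + 1))⁻¹ = η := inv_eq_of_mul_eq_one_left hηL
  have hη0 : 0 < η := Fact.out
  have h52 : pdev (perCfg (towerP L m (n + 1)) U) < α₀ * (((L : ℝ) ^ (n + 1))⁻¹) ^ 2 := by
    have hp := pdev_perCfg_le_of_plaq (U := U) hUb (by positivity) hpl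
    rw [hη]
    exact lt_of_le_of_lt hp (mul_lt_mul_of_pos_right (by linarith) (by positivity))
  -- the two operator norms at this lattice, against the ONE majorant `CG`
  obtain ⟨hGb, hHb⟩ := HL n η hηL c₀ c₁ hw hρ' m hm U αU hα0 hα1 hαL hU1 hreg εU hεU hUε hLb α hα hα1' hUst hUb hUη hpl hUgrad hRlev hεg hAQ hpos' hpos hc₀η
    j₀ hJ hj'' hposπ hQ (L : ℝ) η lev₀ lev₁ levB
  have hMB : 0 ≤ Mφ * B * Mφ' := by positivity
  have hmax : max ((NegSup.wSup (levWeight (L : ℝ) η lev₀ 1) : ℝ) * (Mφ * B * Mφ')) (NegSup.wSup (levWeight (L : ℝ) η lev₁ 2) * (Mφ * B * Mφ')) ≤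
      ω * (Mφ * B * Mφ') :=
    max_le (mul_le_mul_of_nonneg_right hw₀ hMB) (mul_le_mul_of_nonneg_right hw₁ hMB)
  have hGb' : ‖frakGLatticeCLM (L := (L : ℝ)) (η := η) (lev₀ := lev₀) φ hposπ hQ lev₁ (nabla115 η U)‖ ≤ CG := by
    rw [hCGdef]
    exact hGb.trans (mul_le_mul hmax hw₃ (NegSup.wInvSup (levWeight (L : ℝ) η lev₀ 3)).coe_nonneg (by positivity))
  have hHb' : ‖H1LatticeCLM (L := (L : ℝ)) (η := η) (lev₀ := lev₀) (levB := levB) φ hposπ hQ lev₁ (nabla115 η U)‖ ≤ CG := by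
    rw [hCGdef]
    exact hHb.trans (mul_le_mul hmax hwB (NegSup.wInvSup (levWeight (L : ℝ) η levB 0)).coe_nonneg (by positivity))
  have hHpt : ∀ Bf : NegSize (L : ℝ) η levB 0 𝔸,
      ‖H1LatticeCLM (L := (L : ℝ)) (η := η) (lev₀ := lev₀) (levB := levB) φ hposπ hQ lev₁ (nabla115 η U) Bf‖ ≤ CG * ‖Bf‖ :=
    fun Bf => (ContinuousLinearMap.le_opNorm _ Bf).trans (mul_le_mul_of_nonneg_right hHb' (norm_nonneg Bf))
  have hGpt : ∀ f : NegSize (L : ℝ) η lev₀ 3 𝔸,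
      ‖frakGLatticeCLM (L := (L : ℝ)) (η := η) (lev₀ := lev₀) φ hposπ hQ lev₁ (nabla115 η U) f‖ ≤ CG * ‖f‖ :=
    fun f => (ContinuousLinearMap.le_opNorm _ f).trans (mul_le_mul_of_nonneg_right hGb' (norm_nonneg f))
  -- `C_k`'s letters at the radius `ρ` and the Sect. C regime of `(H̃_{1,k}, C_k)` at `(CG, C₂, ρ, a_C, ε_C)`
  have hρc3 : 2 * ρ ≤ c3 d L := by linarith
  have hCk := quadAnalytic_Cck L m η (n + 1) U lev₀ lev₁ (nabla115 η U) levB hL2 hG hUG hα₀ hα3 hα4 h52 hlev hρ hρc3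
  have hCa := analyticOnNhd_Cck L m η (n + 1) U lev₀ lev₁ (nabla115 η U) levB hL2 hG hUG hα₀ hα3 hα4 h52 hlev hρ hρc3
  have RC : Regime (H1LatticeCLM (L := (L : ℝ)) (η := η) (lev₀ := lev₀) (levB := levB) φ hposπ hQ lev₁ (nabla115 η U)) 0
      (Cck L m η (n + 1) U lev₀ lev₁ (nabla115 η U) levB) CG 0 (C2T d α₀) ρ 0 aC εC :=
    Regime.of_normBound_zeroLinear _ hCG hHpt hCk (C2T_nonneg d α₀) hεC.le hCdom
      (by have h0 : 0 ≤ CG * jT := mul_nonneg hCG hjT.le; linarith) hCcontr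
  -- the weight ratio `(Lʲ⁽ᵇ⁾η)³/(Lʲ⁽ᵇ′⁾η)³ ≤ ω³Ω`
  have hratio : ∀ bb b' : Bond d (towerP L m (n + 1)), levWeight (L : ℝ) η lev₀ 3 bb / levWeight (L : ℝ) η lev₀ 3 b' ≤ ϖ := by
    intro bb b'
    have hw3 : ∀ b : Bond d (towerP L m (n + 1)), 0 < levWeight (L : ℝ) η lev₀ 3 b := levWeight_pos (Fact.out : 0 < (L : ℝ)) hη0 lev₀ 3
    have hnum : levWeight (L : ℝ) η lev₀ 3 bb ≤ ω ^ 3 := by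
      have h1 : levWeight (L : ℝ) η lev₀ 1 bb ≤ ω := (NegSup.le_wSup (w := levWeight (L : ℝ) η lev₀ 1) bb).trans hw₀
      have h0 : 0 ≤ levWeight (L : ℝ) η lev₀ 1 bb := (levWeight_pos (Fact.out : 0 < (L : ℝ)) hη0 lev₀ 1 bb).le
      rw [levWeight_apply] at h1 h0 ⊢
      rw [pow_one] at h1 h0
      exact pow_le_pow_left₀ h0 h1 3
    have hden : (levWeight (L : ℝ) η lev₀ 3 b')⁻¹ ≤ Ω := (NegSup.inv_le_wInvSup (w := levWeight (L : ℝ) η lev₀ 3) b').trans hw₃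
    rw [hϖdef, div_eq_mul_inv]
    exact mul_le_mul hnum hden (inv_nonneg.2 (hw3 b').le) (by positivity)
  -- the W-slot: Prop. 4 for `W80` with the lattice-free `(C₄, RW)`
  have hq' : (εC + aC) * (Mφ * B' * Mφ' * (d * B4Sect5Proof.latticeConst d δ')) * (B7Prop5GeneralLevels.C3Gen d L * (2 ^ d * (2 * d))) ≤ 1 / 2 := by
    rw [hΘdef, hΓdef] at hq; exact hq
  obtain ⟨hq98, hWa⟩ := HW n η hηL c₀ c₁ hw hρ' m hm U αU hα0 hα1 hαL hU1 hreg εU hεU hUε hLb α hα hα1'' hUst hUb hUη hpl hUgrad hRlev hεg hAQ hpos' hpos hc₀η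
    j₀ hJ hjW hposπ hQ lev₀ lev₁ (nabla115 η U) levB hL2 hG hUG hα₀ hα3 hα4 h52 hlev hρ hρ4 hθ hC3 RC haC hεaρ hϖ0 hratio
    hq' hCV hRV hMr hMt hMJ hMΔ hRW0 hRWa hRWV ρc τc U hρc hτc hqV J Δπ hJn hΔn
  -- the chart regime at `(CG, C₄, RW)` and the composition, verbatim the host
  have R : Regime (frakGLatticeCLM (L := (L : ℝ)) (η := η) (lev₀ := lev₀) φ hposπ hQ lev₁ (nabla115 η U)) 0
      (W80 ρc τc U (H1LatticeCLM (lev₀ := lev₀) (levB := levB) φ hposπ hQ lev₁ (nabla115 η U))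
        (Cck L m η (n + 1) U lev₀ lev₁ (nabla115 η U) levB) εC J Δπ) CG 0
      (C4W Mr Mt MJ MΔ CG (C2T d α₀) (1 / (1 - 4 * CG * C2T d α₀ * (εC + aC)))
      ((2 * (1 / (1 - 4 * CG * C2T d α₀ * (εC + aC))) + 1) * (ϖ * (Mφ * B' * Mφ' * (d * B4Sect5Proof.latticeConst d δ'))) * (B7Prop5GeneralLevels.C3Gen d L * (2 ^ d * (2 * d))) / aC)
      (2 * (ϖ * (Mφ * B' * Mφ' * (d * B4Sect5Proof.latticeConst d δ'))) * (B7Prop5GeneralLevels.C3Gen d L * (2 ^ d * (2 * d))) * (1 / (1 - 4 * CG * C2T d α₀ * (εC + aC)))) CV RW) RW j a'' ε₄ :=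
    Regime.of_normBound_zeroLinear _ hCG hGpt hq98 hC₄ hε₄.le hdom hself hcontr
  have hRb : ∀ Bf ∈ ball (0 : NegSize (L : ℝ) η levB 0 𝔸) (a'' / (CG + 1)),
      ‖H1LatticeCLM (L := (L : ℝ)) (η := η) (lev₀ := lev₀) (levB := levB) φ hposπ hQ lev₁ (nabla115 η U) Bf‖ < a'' := by
    intro Bf hBf
    rw [mem_ball_zero_iff] at hBf
    calc _ ≤ CG * ‖Bf‖ := hHpt Bf
      _ ≤ CG * (a'' / (CG + 1)) := mul_le_mul_of_nonneg_left hBf.le hCG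
      _ = a'' * (CG / (CG + 1)) := by ring
      _ < a'' := mul_lt_of_lt_one_right ha'' ((div_lt_one (by positivity)).2 (by linarith))
  have hWa' : AnalyticOnNhd ℂ (W80 ρc τc U (H1LatticeCLM (lev₀ := lev₀) (levB := levB) φ hposπ hQ lev₁ (nabla115 η U))
        (Cck L m η (n + 1) U lev₀ lev₁ (nabla115 η U) levB) εC J Δπ) {Y : Space115 (L : ℝ) η lev₀ lev₁ (nabla115 η U) | ‖Y‖ < RW} := hWa
  exact chartHB_triple_of_twoRegimes R hWa' hj.le ha'' RC hCa hcap _ hRb (by positivity) le_rfl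

end Summit.QuantumFields.BalabanUV.T4Continuum.NE9CurChartTowerPiLatticeUniformW80

end
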